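import Summits.ValiantsHypothesis.ValiantsHypothesis.Theorems.LacunarySymmetroidMatrixDescartesCensusDefiniteMiddleK3WalkEnds

/-!
# `MatrixDescartes` census — DOOR A: the INTERIOR-DEFINITE-LETTER LAW AT `(2,3)`, THE WALK, orientation A (identity gauge) —
# given the sorted five roots, the caps/lenses/wraps analysis rules them out

HONEST FRAMING.  Object-search cell `pub-symmetroid`, door-A seat `val-sym-door-p4` (gen 15); items stmt-ValiantsHypothesis-19979
`DoorA26` / 19980 `DoorA34` (OPEN, typed, never asserted); helper `--supports 19979`, NO closure claim.  This is the `K = 3`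
instance of the cell's conjecture C-g3-2 / the interior-definite-letter law (theory g3 proved it on paper as THEOREM L5(iii) by
rigidity + certified anchors; here a direct kernel proof), in the IDENTITY GAUGE `S₁ = 1` (a positive definite middle letter is
congruent to `1`; congruence preserves det-roots — not re-derived here).  `D(2,3) = 5`, so this is the one-unit Descartes
deficiency `≤ 4`.  Nothing here bounds `ζ_sym(2,6)`, decides `DoorA26`/`DoorA34`, or bears on `MatrixDescartes`
(stmt-ValiantsHypothesis-18050) / `VP ≠ VNP`; the `K = 6` law IDL26 (worth `990` open chambers, `…CensusInteriorDefiniteBridge`)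
stays OPEN.

PROOF (memo `IDL-doorp4g15.md` §3).  Five distinct positive roots are Descartes-sharp (six monomials), hence simple and the only
ones; `det F` alternates on the six gaps; on a positive gap `F` is definite of a constant type.  WALK: with three caps of types
`(T₁,T₂,T₃)` — (i) all equal: every root bounds a cap of type `T`, so `T·tr F(rᵢ) ≥ 0` at all five roots, contradicting the
future-type law (`T = +`, `…FutureTypeK3`: ≤ 2) or the past-type law (`T = −`, `…PastTypeK3`: ≤ 4); (ii) a lens next to a wrap
(`(T,T,−T)` or `(T,−T,−T)`): a compression that is `−T`-signed inside the lens changes sign three times — impossible for a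
trinomial (`comp_three_sign_changes`); (iii) two wraps `(T,−T,T)`: the end letter on the side of the first cap is `T`-definite
(endpoint continuity / end behaviour) and the other end letter is not `(−T)`-definite (end behaviour of `det F`), so some
compression is `T`-signed everywhere, contradicting the middle cap.

* **`no_five_roots_of_walkA`** — the walk (`det F > 0` on the first gap: caps `(0,r₀), (r₁,r₂), (r₃,r₄)`): from the root data of `five_roots_structure` (`…K3Roots`, stated here as hypotheses so that
  the two files elaborate independently) to `False`; the law itself is assembled in `…DefiniteMiddleK3Law`.

[folklore] Descartes' rule of signs with multiplicity (Mathlib `Polynomial.roots_countP_pos_le_signVariations`, the tree's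
`signVariations_lt_card_support`), intermediate value theorem; elementary.  Axioms standard; no definitions.
-/

-- the D-0017 layout repeats a namespace component (single-conjunct summit); the `dupNamespace` linter flags it; name mandated.
set_option linter.dupNamespace false

namespace Summit.ValiantsHypothesis.ValiantsHypothesis.Theorems.LacunarySymmetroidMatrixDescartes.Census.DefiniteMiddle

open Real Matrix Finset Polynomial
open scoped BigOperators
open Literature.Topology.PlanarFoliations (mul_pos_of_mul_pos_of_mul_pos)

/-! ## The walk -/

set_option maxHeartbeats 8000000 in
/-- **THE WALK, orientation A** (`det F > 0` on the first gap: caps `(0,r₀), (r₁,r₂), (r₃,r₄)`).  Let `S₀, S₂` be real symmetric, `0 < d < e`, `P = det(S₀ + X^d·1 + X^e·S₂)`, and let `r 0 < ⋯ < r 4` be positive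
roots of `P` with no positive root of `P` below `r 0`, strictly between consecutive ones, or above `r 4`, with `P` changing sign
across each of them (products at consecutive gap midpoints negative) and `det S₀ ≠ 0 ≠ det S₂`.  Then `False`: caps of one type
contradict the future/past-type laws, a lens next to a wrap contradicts `comp_three_sign_changes`, two wraps contradict the end
letters. [folklore] -/
theorem no_five_roots_of_walkA (S₀ S₂ : Matrix (Fin 2) (Fin 2) ℝ) (hS₀ : S₀.IsSymm) (hS₂ : S₂.IsSymm)
    {d e : ℕ} (hd : 0 < d) (hde : d < e) (r : Fin 5 → ℝ) (hrmono : StrictMono r) (hrpos : ∀ i, 0 < r i)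
    (hrroot : ∀ i, (Matrix.det (S₀.map C + (X : ℝ[X]) ^ d • (1 : Matrix (Fin 2) (Fin 2) ℝ[X]) + (X : ℝ[X]) ^ e • S₂.map C)
      ).eval (r i) = 0)
    (hgap0 : ∀ z, 0 < z → z < r 0 → (Matrix.det (S₀.map C + (X : ℝ[X]) ^ d • (1 : Matrix (Fin 2) (Fin 2) ℝ[X])
      + (X : ℝ[X]) ^ e • S₂.map C)).eval z ≠ 0)
    (hgap : ∀ (i : Fin 5) (z : ℝ), r i < z → (∀ j : Fin 5, i < j → z < r j) → (Matrix.det (S₀.map C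
      + (X : ℝ[X]) ^ d • (1 : Matrix (Fin 2) (Fin 2) ℝ[X]) + (X : ℝ[X]) ^ e • S₂.map C)).eval z ≠ 0)
    (halt : let P := Matrix.det (S₀.map C + (X : ℝ[X]) ^ d • (1 : Matrix (Fin 2) (Fin 2) ℝ[X]) + (X : ℝ[X]) ^ e • S₂.map C)
       P.eval (r 0 / 2) * P.eval ((r 0 + r 1) / 2) < 0 ∧ P.eval ((r 0 + r 1) / 2) * P.eval ((r 1 + r 2) / 2) < 0 ∧
       P.eval ((r 1 + r 2) / 2) * P.eval ((r 2 + r 3) / 2) < 0 ∧ P.eval ((r 2 + r 3) / 2) * P.eval ((r 3 + r 4) / 2) < 0 ∧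
       P.eval ((r 3 + r 4) / 2) * P.eval (r 4 + 1) < 0)
    (hdS₀ : S₀ 0 0 * S₀ 1 1 - S₀ 0 1 ^ 2 ≠ 0)
    (hA : 0 < (Matrix.det (S₀.map C + (X : ℝ[X]) ^ d • (1 : Matrix (Fin 2) (Fin 2) ℝ[X]) + (X : ℝ[X]) ^ e • S₂.map C)
      ).eval (r 0 / 2)) : False := by
  classical
  set Pm := Matrix.det (S₀.map C + (X : ℝ[X]) ^ d • (1 : Matrix (Fin 2) (Fin 2) ℝ[X]) + (X : ℝ[X]) ^ e • S₂.map C)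
    with hPm
  have he : 0 < e := lt_trans hd hde
  have h10 : S₀ 1 0 = S₀ 0 1 := hS₀.apply 0 1
  have h10' : S₂ 1 0 = S₂ 0 1 := hS₂.apply 0 1
  have hFsym : ∀ x : ℝ, (S₀ + x ^ d • (1 : Matrix (Fin 2) (Fin 2) ℝ) + x ^ e • S₂) 1 0
      = (S₀ + x ^ d • (1 : Matrix (Fin 2) (Fin 2) ℝ) + x ^ e • S₂) 0 1 := by
    intro x; rw [pencil_apply, pencil_apply, h10]; simp [h10']
  have hev : ∀ x, Pm.eval x = (S₀ + x ^ d • (1 : Matrix (Fin 2) (Fin 2) ℝ) + x ^ e • S₂).det :=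
    fun x => by rw [hPm]; exact eval_det_pencilPoly S₀ S₂ d e x
  have hPev : ∀ x, Pm.eval x = (S₀ 0 0 * S₀ 1 1 - S₀ 0 1 ^ 2) * x ^ 0 + (S₀ 0 0 + S₀ 1 1) * x ^ d
      + 1 * x ^ (2 * d) + (S₀ 0 0 * S₂ 1 1 + S₀ 1 1 * S₂ 0 0 - 2 * (S₀ 0 1 * S₂ 0 1)) * x ^ e
      + (S₂ 0 0 + S₂ 1 1) * x ^ (d + e) + (S₂ 0 0 * S₂ 1 1 - S₂ 0 1 ^ 2) * x ^ (2 * e) := fun x => by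
    rw [hev]; exact det_pencil_eq S₀ S₂ hS₀ hS₂ d e x
  -- ### the walk data
  obtain ⟨alt01, alt12, alt23, alt34, alt45⟩ := halt
  set m : Fin 6 → ℝ := ![r 0 / 2, (r 0 + r 1) / 2, (r 1 + r 2) / 2, (r 2 + r 3) / 2, (r 3 + r 4) / 2, r 4 + 1]
    with hm
  have hm0 : m 0 = r 0 / 2 := rfl
  have hm1 : m 1 = (r 0 + r 1) / 2 := rfl
  have hm2 : m 2 = (r 1 + r 2) / 2 := rfl
  have hm3 : m 3 = (r 2 + r 3) / 2 := rfl
  have hm4 : m 4 = (r 3 + r 4) / 2 := rfl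
  have hm5 : m 5 = r 4 + 1 := rfl
  rw [← hm0, ← hm1] at alt01
  rw [← hm1, ← hm2] at alt12
  rw [← hm2, ← hm3] at alt23
  rw [← hm3, ← hm4] at alt34
  rw [← hm4, ← hm5] at alt45
  have h01 := hrmono (show (0 : Fin 5) < 1 by decide)
  have h12 := hrmono (show (1 : Fin 5) < 2 by decide)
  have h23 := hrmono (show (2 : Fin 5) < 3 by decide)
  have h34 := hrmono (show (3 : Fin 5) < 4 by decide)
  have hr0 := hrpos 0
  -- ### the pencil value as an opaque function
  obtain ⟨F, hF⟩ : ∃ F : ℝ → Matrix (Fin 2) (Fin 2) ℝ,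
      ∀ x, F x = S₀ + x ^ d • (1 : Matrix (Fin 2) (Fin 2) ℝ) + x ^ e • S₂ := ⟨_, fun _ => rfl⟩
  have hF00 : ∀ x, F x 0 0 = S₀ 0 0 + x ^ d + x ^ e * S₂ 0 0 := fun x => by
    rw [hF, pencil_apply]; simp
  have hF11 : ∀ x, F x 1 1 = S₀ 1 1 + x ^ d + x ^ e * S₂ 1 1 := fun x => by
    rw [hF, pencil_apply]; simp
  have hFs : ∀ x, F x 1 0 = F x 0 1 := fun x => by rw [hF]; exact hFsym x
  have hdetF : ∀ x, (F x).det = Pm.eval x := fun x => by rw [hF, hev]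
  have hdetF' : ∀ x, (F x).det = F x 0 0 * F x 1 1 - F x 0 1 ^ 2 := fun x => by
    rw [Matrix.det_fin_two, hFs, sq]
  have hquad : ∀ x v, v ⬝ᵥ (F x *ᵥ v) = v ⬝ᵥ (S₀ *ᵥ v) + (v ⬝ᵥ v) * x ^ d + (v ⬝ᵥ (S₂ *ᵥ v)) * x ^ e :=
    fun x v => by rw [hF, quadform_pencil]
  have he0 : ∀ x v, v ⬝ᵥ (F x *ᵥ v) = F x 0 0 * v 0 ^ 2 + 2 * F x 0 1 * v 0 * v 1 + F x 1 1 * v 1 ^ 2 :=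
    fun x v => quadform_eq (F x) (hFs x) v
  have hcont00 : Continuous fun x => F x 0 0 := by simp only [hF00]; fun_prop
  have hcontTr : Continuous fun x => F x 0 0 + F x 1 1 := by simp only [hF00, hF11]; fun_prop
  have hcontP : Continuous fun x => Pm.eval x := Pm.continuous
  have hvv : ∀ v : Fin 2 → ℝ, v ≠ 0 → 0 < v ⬝ᵥ v := fun v hv => by
    have : v ⬝ᵥ v = v 0 ^ 2 + v 1 ^ 2 := by simp [dotProduct, Fin.sum_univ_two, sq]
    rw [this]
    rcases Function.ne_iff.mp hv with ⟨i, hi⟩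
    fin_cases i
    · have hi' : v 0 ≠ 0 := by simpa using hi
      have : 0 < v 0 ^ 2 := by positivity
      nlinarith [sq_nonneg (v 1)]
    · have hi' : v 1 ≠ 0 := by simpa using hi
      have : 0 < v 1 ^ 2 := by positivity
      nlinarith [sq_nonneg (v 0)]
  -- ### gap lemmas: no root in (0, r 0), (r i, r (i+1)), (r 4, ∞)
  have hg1 : ∀ z, r 0 < z → z < r 1 → Pm.eval z ≠ 0 := fun z h1 h2 =>
    hgap 0 z h1 (fun j hj => lt_of_lt_of_le h2 (hrmono.monotone (by omega)))
  have hg2 : ∀ z, r 1 < z → z < r 2 → Pm.eval z ≠ 0 := fun z h1 h2 =>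
    hgap 1 z h1 (fun j hj => lt_of_lt_of_le h2 (hrmono.monotone (by omega)))
  have hg3 : ∀ z, r 2 < z → z < r 3 → Pm.eval z ≠ 0 := fun z h1 h2 =>
    hgap 2 z h1 (fun j hj => lt_of_lt_of_le h2 (hrmono.monotone (by omega)))
  have hg4 : ∀ z, r 3 < z → z < r 4 → Pm.eval z ≠ 0 := fun z h1 h2 =>
    hgap 3 z h1 (fun j hj => lt_of_lt_of_le h2 (hrmono.monotone (by omega)))
  have hg5 : ∀ z, r 4 < z → Pm.eval z ≠ 0 := fun z h1 =>
    hgap 4 z h1 (fun j hj => absurd hj (by omega))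
  -- constant sign on each gap, relative to its sample point
  have same0 : ∀ x, 0 < x → x < r 0 → 0 < Pm.eval x * Pm.eval (m 0) := by
    intro x hx hx'
    rcases le_total x (m 0) with h | h
    · exact same_sign_of_no_zero hcontP h (fun z hz1 hz2 => hgap0 z (by linarith) (by rw [hm0] at hz2; linarith))
    · rw [mul_comm]
      exact same_sign_of_no_zero hcontP h (fun z hz1 hz2 => hgap0 z (by rw [hm0] at hz1; linarith) (by linarith))
  have same1 : ∀ x, r 0 < x → x < r 1 → 0 < Pm.eval x * Pm.eval (m 1) := by
    intro x hx hx'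
    rcases le_total x (m 1) with h | h
    · exact same_sign_of_no_zero hcontP h (fun z hz1 hz2 => hg1 z (by linarith) (by rw [hm1] at hz2; linarith))
    · rw [mul_comm]
      exact same_sign_of_no_zero hcontP h (fun z hz1 hz2 => hg1 z (by rw [hm1] at hz1; linarith) (by linarith))
  have same2 : ∀ x, r 1 < x → x < r 2 → 0 < Pm.eval x * Pm.eval (m 2) := by
    intro x hx hx'
    rcases le_total x (m 2) with h | h
    · exact same_sign_of_no_zero hcontP h (fun z hz1 hz2 => hg2 z (by linarith) (by rw [hm2] at hz2; linarith))
    · rw [mul_comm]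
      exact same_sign_of_no_zero hcontP h (fun z hz1 hz2 => hg2 z (by rw [hm2] at hz1; linarith) (by linarith))
  have same3 : ∀ x, r 2 < x → x < r 3 → 0 < Pm.eval x * Pm.eval (m 3) := by
    intro x hx hx'
    rcases le_total x (m 3) with h | h
    · exact same_sign_of_no_zero hcontP h (fun z hz1 hz2 => hg3 z (by linarith) (by rw [hm3] at hz2; linarith))
    · rw [mul_comm]
      exact same_sign_of_no_zero hcontP h (fun z hz1 hz2 => hg3 z (by rw [hm3] at hz1; linarith) (by linarith))
  have same4 : ∀ x, r 3 < x → x < r 4 → 0 < Pm.eval x * Pm.eval (m 4) := by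
    intro x hx hx'
    rcases le_total x (m 4) with h | h
    · exact same_sign_of_no_zero hcontP h (fun z hz1 hz2 => hg4 z (by linarith) (by rw [hm4] at hz2; linarith))
    · rw [mul_comm]
      exact same_sign_of_no_zero hcontP h (fun z hz1 hz2 => hg4 z (by rw [hm4] at hz1; linarith) (by linarith))
  have same5 : ∀ x, r 4 < x → 0 < Pm.eval x * Pm.eval (m 5) := by
    intro x hx
    rcases le_total x (m 5) with h | h
    · exact same_sign_of_no_zero hcontP h (fun z hz1 hz2 => hg5 z (by linarith))
    · rw [mul_comm]
      exact same_sign_of_no_zero hcontP h (fun z hz1 hz2 => hg5 z (by rw [hm5] at hz1; linarith))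
  -- the two analytic laws, in `F`-form
  have future3 : ∀ x₁ x₂ x₃ : ℝ, 0 < x₁ → x₁ < x₂ → x₂ < x₃ →
      Pm.eval x₁ = 0 → Pm.eval x₂ = 0 → Pm.eval x₃ = 0 →
      0 ≤ F x₁ 0 0 + F x₁ 1 1 → 0 ≤ F x₂ 0 0 + F x₂ 1 1 → 0 ≤ F x₃ 0 0 + F x₃ 1 1 → False := by
    intro x₁ x₂ x₃ h0 h12 h23 hz1 hz2 hz3 ht1 ht2 ht3
    refine futureType_three_roots S₀ S₂ hS₀ hS₂ hd hde h0 h12 h23 ?_ ?_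
    · intro x hx; simp only [List.mem_cons, List.not_mem_nil, or_false] at hx
      rcases hx with rfl | rfl | rfl
      · rw [← hF, hdetF]; exact hz1
      · rw [← hF, hdetF]; exact hz2
      · rw [← hF, hdetF]; exact hz3
    · intro x hx; simp only [List.mem_cons, List.not_mem_nil, or_false] at hx
      rcases hx with rfl | rfl | rfl
      · rw [← hF, Matrix.trace_fin_two]; exact ht1
      · rw [← hF, Matrix.trace_fin_two]; exact ht2
      · rw [← hF, Matrix.trace_fin_two]; exact ht3
  have past5 : (∀ i, F (r i) 0 0 + F (r i) 1 1 ≤ 0) → False := by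
    intro htr
    refine pastType_five_roots S₀ S₂ hS₀ hS₂ hd hde (fun i => r i) hrmono hr0 (fun i => ?_) (fun i => ?_)
    · rw [← hF, hdetF]; exact hrroot i
    · rw [← hF, Matrix.trace_fin_two]; exact htr i
  -- a root has det 0, so under a type-`T` trace inequality it is of that type
  -- ### the walk: case split on the sign of `det F` on the first gap
  rw [← hm0] at hA
  have hP1 : Pm.eval (m 1) < 0 := sgn_neg_of_mul_neg_of_pos alt01 hA
  have hP2 : 0 < Pm.eval (m 2) := pos_of_mul_neg_of_neg alt12 hP1
  have hP3 : Pm.eval (m 3) < 0 := sgn_neg_of_mul_neg_of_pos alt23 hP2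
  have hP4 : 0 < Pm.eval (m 4) := pos_of_mul_neg_of_neg alt34 hP3
  have hP5 : Pm.eval (m 5) < 0 := sgn_neg_of_mul_neg_of_pos alt45 hP4
  obtain ⟨T0, hT0, hdef0'⟩ := cap_definite S₀ S₂ hS₀ hS₂ d e (lo := 0) (hi := r 0) (mm := m 0)
    (by rw [hm0]; linarith) (by rw [hm0]; linarith)
    (fun x hx hx' => by rw [← hF, hdetF]; exact pos_of_mul_pos_left (same0 x hx hx') hA.le)
  obtain ⟨T2, hT2, hdef2'⟩ := cap_definite S₀ S₂ hS₀ hS₂ d e (lo := r 1) (hi := r 2) (mm := m 2)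
    (by rw [hm2]; linarith) (by rw [hm2]; linarith)
    (fun x hx hx' => by rw [← hF, hdetF]; exact pos_of_mul_pos_left (same2 x hx hx') hP2.le)
  obtain ⟨T4, hT4, hdef4'⟩ := cap_definite S₀ S₂ hS₀ hS₂ d e (lo := r 3) (hi := r 4) (mm := m 4)
    (by rw [hm4]; linarith) (by rw [hm4]; linarith)
    (fun x hx hx' => by rw [← hF, hdetF]; exact pos_of_mul_pos_left (same4 x hx hx') hP4.le)
  have hdef0 : ∀ x, 0 < x → x < r 0 → ∀ v : Fin 2 → ℝ, v ≠ 0 → 0 < T0 * (v ⬝ᵥ (F x *ᵥ v)) :=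
    fun x hx hx' v hv => by rw [hF]; exact hdef0' x hx hx' v hv
  have hdef2 : ∀ x, r 1 < x → x < r 2 → ∀ v : Fin 2 → ℝ, v ≠ 0 → 0 < T2 * (v ⬝ᵥ (F x *ᵥ v)) :=
    fun x hx hx' v hv => by rw [hF]; exact hdef2' x hx hx' v hv
  have hdef4 : ∀ x, r 3 < x → x < r 4 → ∀ v : Fin 2 → ℝ, v ≠ 0 → 0 < T4 * (v ⬝ᵥ (F x *ᵥ v)) :=
    fun x hx hx' v hv => by rw [hF]; exact hdef4' x hx hx' v hv
  -- trace signs at the five roots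
  have t0 : 0 ≤ T0 * (F (r 0) 0 0 + F (r 0) 1 1) := by
    rw [hF]; exact trace_at_right_end S₀ S₂ hS₀ hS₂ d e T0 hr0 hdef0'
  have t1 : 0 ≤ T2 * (F (r 1) 0 0 + F (r 1) 1 1) := by
    rw [hF]; exact trace_at_left_end S₀ S₂ hS₀ hS₂ d e T2 h12 hdef2'
  have t2 : 0 ≤ T2 * (F (r 2) 0 0 + F (r 2) 1 1) := by
    rw [hF]; exact trace_at_right_end S₀ S₂ hS₀ hS₂ d e T2 h12 hdef2'
  have t3 : 0 ≤ T4 * (F (r 3) 0 0 + F (r 3) 1 1) := by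
    rw [hF]; exact trace_at_left_end S₀ S₂ hS₀ hS₂ d e T4 h34 hdef4'
  have t4 : 0 ≤ T4 * (F (r 4) 0 0 + F (r 4) 1 1) := by
    rw [hF]; exact trace_at_right_end S₀ S₂ hS₀ hS₂ d e T4 h34 hdef4'
  -- indefinite sample points in the passages
  have hind1 : F (m 1) 0 0 * F (m 1) 1 1 - F (m 1) 0 1 ^ 2 < 0 := by rw [← hdetF', hdetF]; exact hP1
  have hind3 : F (m 3) 0 0 * F (m 3) 1 1 - F (m 3) 0 1 ^ 2 < 0 := by rw [← hdetF', hdetF]; exact hP3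
  have hm0pos : 0 < m 0 := by rw [hm0]; linarith
  have hm01 : m 0 < m 1 := by rw [hm0, hm1]; linarith
  have hm12 : m 1 < m 2 := by rw [hm1, hm2]; linarith
  have hm23 : m 2 < m 3 := by rw [hm2, hm3]; linarith
  have hm34 : m 3 < m 4 := by rw [hm3, hm4]; linarith
  have hm45 : m 4 < m 5 := by rw [hm4, hm5]; linarith
  have d0 := fun v hv => hdef0 (m 0) hm0pos (by rw [hm0]; linarith) v hv
  have d2 := fun v hv => hdef2 (m 2) (by rw [hm2]; linarith) (by rw [hm2]; linarith) v hv
  have d4 := fun v hv => hdef4 (m 4) (by rw [hm4]; linarith) (by rw [hm4]; linarith) v hv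
  by_cases hT02 : T2 = T0
  · by_cases hT24 : T4 = T0
    · -- one nappe: all five roots of type `T0`
      subst hT02; subst hT24
      rcases hT0 with rfl | rfl
      · exact future3 (r 0) (r 1) (r 2) hr0 h01 h12 (hrroot 0) (hrroot 1) (hrroot 2) (by linarith) (by linarith)
          (by linarith)
      · refine past5 (fun i => ?_)
        fin_cases i <;> simp <;> linarith
    · -- lens then wrap: `(T0, T0, −T0)`
      subst hT02
      have hT4' : T4 = -T2 := eq_neg_of_ne_sign hT2 hT4 hT24
      obtain ⟨v, hv⟩ := exists_mul_quadform_neg_of_det_neg (F (m 1)) (hFs _) hind1 T2 hT2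
      have hv0 : v ≠ 0 := by rintro rfl; simp at hv
      refine comp_three_sign_changes S₀ S₂ d e v T2 hm0pos hm01 hm12 (lt_trans hm23 hm34) ?_ ?_ ?_ ?_
      · rw [← hF]; exact d0 v hv0
      · rw [← hF]; exact hv
      · rw [← hF]; exact d2 v hv0
      · rw [← hF]; have := d4 v hv0; rw [hT4'] at this; linarith
  · have hT2' : T2 = -T0 := eq_neg_of_ne_sign hT0 hT2 hT02
    by_cases hT24 : T4 = T0
    · -- two wraps: `(T0, −T0, T0)`
      -- (a) `S₀ = F 0` is `T0`-definite
      have hF0 : F 0 = S₀ := by rw [hF, zero_pow hd.ne', zero_pow he.ne']; simp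
      have hP0nn : 0 ≤ Pm.eval 0 :=
        nonneg_of_pos_on_right (f := fun x => Pm.eval x) hr0 hcontP.continuousAt
          (fun x hx hx' => pos_of_mul_pos_left (same0 x hx hx') hA.le)
      have hdetS₀ : 0 < S₀ 0 0 * S₀ 1 1 - S₀ 0 1 ^ 2 := by
        have hev0 : Pm.eval 0 = S₀ 0 0 * S₀ 1 1 - S₀ 0 1 ^ 2 := by
          rw [← hdetF, hF0, Matrix.det_fin_two, h10, sq]
        rw [← hev0]
        exact lt_of_le_of_ne hP0nn (by rw [hev0]; exact hdS₀.symm)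
      have hS₀def : ∀ v : Fin 2 → ℝ, v ≠ 0 → 0 < T0 * (v ⬝ᵥ (S₀ *ᵥ v)) := by
        intro v hv
        have h1 : 0 < S₀ 0 0 * (v ⬝ᵥ (S₀ *ᵥ v)) := mul_quadform_pos_of_det_pos S₀ h10 hdetS₀ v hv
        have h2 : 0 ≤ T0 * F 0 0 0 := by
          refine nonneg_of_pos_on_right (f := fun x => T0 * F x 0 0) hr0
            ((continuous_const.mul hcont00).continuousAt) (fun x hx hx' => ?_)
          have := hdef0 x hx hx' ![1, 0] (by intro h; have := congrFun h 0; simp at this)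
          rw [he0] at this; simpa using this
        rw [hF0] at h2
        have h00 : S₀ 0 0 ≠ 0 := by
          intro h0; rw [h0, zero_mul] at hdetS₀; nlinarith [sq_nonneg (S₀ 0 1)]
        have h3 : 0 < T0 * S₀ 0 0 := by
          rcases lt_or_eq_of_le h2 with h | h
          · exact h
          · exfalso; rcases hT0 with rfl | rfl <;> simp at h <;> exact h00 (by linarith)
        exact mul_pos_of_mul_pos_of_mul_pos h3 h1
      -- (b) `S₂` is not definite: `det S₂ ≤ 0` from the sign of `det F` at `+∞`
      have hdetS₂ : S₂ 0 0 * S₂ 1 1 - S₂ 0 1 ^ 2 ≤ 0 := by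
        by_contra hpos
        rw [not_le] at hpos
        have := top_coeff_sign (S₀ 0 0 * S₀ 1 1 - S₀ 0 1 ^ 2) (S₀ 0 0 + S₀ 1 1)
          (S₀ 0 0 * S₂ 1 1 + S₀ 1 1 * S₂ 0 0 - 2 * (S₀ 0 1 * S₂ 0 1)) (S₂ 0 0 + S₂ 1 1)
          (S₂ 0 0 * S₂ 1 1 - S₂ 0 1 ^ 2) hde (-1) (r 4) (Or.inr rfl) hpos.ne' (fun x hx => by
            have hneg : Pm.eval x < 0 := by
              have hs := same5 x hx
              rcases mul_pos_iff.mp hs with ⟨_, h2'⟩ | ⟨h1', _⟩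
              · exact absurd hP5 (not_lt.mpr h2'.le)
              · exact h1'
            rw [hPev] at hneg; linarith)
        linarith
      have hS₂v : ∃ v : Fin 2 → ℝ, v ≠ 0 ∧ 0 ≤ v ⬝ᵥ (S₂ *ᵥ v) := by
        by_contra hno
        push Not at hno
        have := det_pos_of_definite S₂ h10' (-1) (fun v hv => by have := hno v hv; linarith)
        linarith
      obtain ⟨v, hv0, hvS₂⟩ := hS₂v
      have g2 := d2 v hv0
      have g4 := d4 v hv0
      rw [hT2', hquad] at g2
      rw [hT24, hquad] at g4
      have gS₀ := hS₀def v hv0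
      have hvv' := hvv v hv0
      have hm2pos : 0 < m 2 := lt_trans hm0pos (lt_trans hm01 hm12)
      have hm2d : 0 < (m 2) ^ d := pow_pos hm2pos d
      have hm2e : 0 < (m 2) ^ e := pow_pos hm2pos e
      rcases hT0 with rfl | rfl
      · -- `T0 = 1`: every term of the compression at `m 2` is nonnegative, the first positive
        have : 0 ≤ v ⬝ᵥ (S₂ *ᵥ v) * m 2 ^ e := mul_nonneg hvS₂ hm2e.le
        nlinarith
      · -- `T0 = −1`: the compression is increasing, but positive at `m 2` and negative at `m 4`
        have hm24 : m 2 ≤ m 4 := by linarith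
        have hd' : (m 2) ^ d ≤ (m 4) ^ d := pow_le_pow_left₀ hm2pos.le hm24 d
        have he' : (m 2) ^ e ≤ (m 4) ^ e := pow_le_pow_left₀ hm2pos.le hm24 e
        have := mul_le_mul_of_nonneg_left he' hvS₂
        nlinarith
    · -- wrap then lens: `(T0, −T0, −T0)`
      have hT4' : T4 = -T0 := eq_neg_of_ne_sign hT0 hT4 hT24
      have hnT0 : (-T0) = 1 ∨ (-T0) = -1 := by rcases hT0 with rfl | rfl <;> norm_num
      obtain ⟨v, hv⟩ := exists_mul_quadform_neg_of_det_neg (F (m 3)) (hFs _) hind3 (-T0) hnT0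
      have hv0 : v ≠ 0 := by rintro rfl; simp at hv
      refine comp_three_sign_changes S₀ S₂ d e v T0 hm0pos (lt_trans hm01 hm12) hm23 hm34 ?_ ?_ ?_ ?_
      · rw [← hF]; exact d0 v hv0
      · rw [← hF]; have := d2 v hv0; rw [hT2'] at this; linarith
      · rw [← hF]; linarith
      · rw [← hF]; have := d4 v hv0; rw [hT4'] at this; linarith
end Summit.ValiantsHypothesis.ValiantsHypothesis.Theorems.LacunarySymmetroidMatrixDescartes.Census.DefiniteMiddle
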